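import Literature.NumberTheory.Rogawski1990.SmoothTransferSplitPlaceAssembly
import Literature.NumberTheory.Rogawski1990.FinExplicitTransferFactorBoxReindex
import Literature.NumberTheory.Automorphic.GLnLeviSmoothTransport
import Literature.NumberTheory.Automorphic.AddCharConductorExponent
import Literature.NumberTheory.Automorphic.AdicCompletionResidueCard
import Literature.NumberTheory.Rogawski1990.SmoothTransferSplitPlaceGSide        -- ★ B5-R p839397 (ED. 2)
import Literature.NumberTheory.Rogawski1990.SmoothTransferSplitPlaceHSide        -- ★ B5-L p838984 (ED. 2)
import Literature.NumberTheory.Rogawski1990.FinExplicitTransferFactorSplitPlaceTau  -- ★ B6 p838966 (ED. 2)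
import Literature.NumberTheory.Rogawski1990.FinExplicitTransferFactorNondegenerate  -- ★ `isUnit_eval_finCharpolyTwo_of_isLocalGRegular` (ED. 2)
import Literature.NumberTheory.Rogawski1990.LocalTransferLinear                   -- ★ `isRegularElt_of_isLocalNormPair` (ED. 2)
import Literature.NumberTheory.Rogawski1990.GRegularLocalisation                  -- ★ `isLocalGRegular_out_mk` (ED. 2)
import Literature.NumberTheory.Automorphic.GLnStandardLeviTwoBlockModel           -- ★ A-p16 (l1)(l2) (ED. 2)
import Literature.NumberTheory.Automorphic.GLnStandardLeviTwoOnePoint             -- ★ B4″ (ED. 2)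
import Literature.NumberTheory.Automorphic.OrbitalMeasureCanonicalExists          -- ★ one canonical `ρ` per Levi point (ED. 2)
import Literature.NumberTheory.Automorphic.GLnLeviWeightClassFunction             -- ★ p04 ψ-RIDERS p839418 (ED. 2)
import Literature.NumberTheory.Automorphic.LocalUnitaryGroupCongrMeasure          -- ★ instances on `(cmDatum …).Local v` (ED. 2)
import Literature.NumberTheory.Automorphic.UnitaryGroupPureTensorEulerProduct     -- ★ `GL_N(L_w)` locally compact ∕ second countable (ED. 2)
import Literature.NumberTheory.Automorphic.GLnIwasawaIntegration                  -- ★ `isInvInvariant_of_isMulRightInvariant` (ED. 2)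
import HarnessLib

/-!
# The scalar identity of the split-place transfer BY NAME: `Δ‴_v(γ_H, γ′) · w(p) = C · τ_v(γ_H) · ‖det K_p‖_w^{1∕2}`
# — Rogawski's `Δ_{G∕H} = τ D_{G∕H}` against the Jacobian `‖det(1 − K_p)‖⁻¹ ‖det K_p‖` of Lemma 4.13.1 (a)

Topic `NumberTheory/Rogawski1990`; namespace `Literature.NumberTheory.Rogawski1990`.  THEOREMS ONLY (no definition, no instance, no notation,
no named fact, no `sorry`).  Cell `pub/hodgecm-mathlib`, programme P3a, road «D-N6s», brick **B5-A PART 2 (a)** (the head (A2) of the cut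
00:17:44Z, now BY NAME; LEAD T7-25 (5)); PART 2 (b), the instantiation of ★ `isLocalDeltaTransferExists_of_split_of_forall_pair` at
`φᴴ := (ψ · CTφ′) ∘ j̃` with B5-L ∕ B5-R ∕ B6 ∕ (A1) by name, is APPENDED here when those land.  Inputs, all ★: `finExplicitDelta_eq_tau_mul_weyl_of_split` (★ D-S2: at a split place
`Δ‴_v(γ_H, γ′) = τ_v(γ_H) · D_{G∕H,v}(γ_H)`, sign `+1`), `finWeylRatio_eq_boxAd_of_split` (★ D-S2r: `D_{G∕H,v}(γ_H) = ‖det(1 − K_p)‖_w ‖det K_p‖_w^{−1∕2}`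
in the D-S1 box `K_p` of a two-block Levi element `p = diag(m false, m true)` carrying the blocks `(g_w, u_w)` of `γ_H`), the descent constant
`w(p) = (C · ‖det(1 − K_p)‖⁻¹ · ‖det K_p‖).toReal` of ★ `exists_integral_descConj_quotientMeasure_eq_smul_integral_levi` (Lemma 4.13.1 (a), Bochner
form, `normAbs` currency) and the arithmetic ★ `delta_mul_w_eq_psi` (B5-A PART 1).  The one conversion is `‖x‖ = normAbs L_w x` on `L_w`
(`norm_eq_coe_normAbs_adicCompletion`, the tree's ★ `GlobalHeckeTheoryGL2OfCenterInvariant.norm_eq_coe_normAbs` reproduced to keep the import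
closure inside the Rogawski corner).

* (private) `norm_eq_coe_normAbs_adicCompletion` — `‖x‖ = ↑(normAbs (v.adicCompletion K) x)`; `det K_p ≠ 0` is ★
  `GLnLeviSmoothTransport.det_boxAd_ne_zero` (B-p12, the (A1) riders — imported here, as PART 2 (b) reads its `IsLocSmooth` heads).
* **`finExplicitDelta_mul_toReal_eq_of_split`** — for `γ_H = a`, a match `γ′ = b` (`IsLocalNormPair`), `χ_{g}(u)` a unit, block data
  `(hg, ht)` as in ★ D-S2r, any `C : ℝ≥0∞` and `τ_v(γ_H) = χ`:
  `Δ‴_v(a, b) · w(p) = C.toReal · χ · √‖det K_p‖_w` — the scalar input `hA2` of ★ `classOrbital_pair_identity_of_sides` with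
  `ψ(p_M) := C.toReal · χ(p_M) · ‖det K_{p_M}‖^{1∕2}`.
HONEST LABEL: HC_CM is proved only modulo the printed citations until rung 0 closes; this file proves none of them.

## References
* [Rogawski1990] J. D. Rogawski, *Automorphic Representations of Unitary Groups in Three Variables*, Ann. of Math. Stud. 123 (1990), §4.9
  p. 55 (`Δ_{G∕H} = τ D_{G∕H}`), §4.13 Lemma 4.13.1 (a) pp. 64–66, §14.6 p. 242.
* [TateThesis1967] J. Tate, *Fourier analysis in number fields and Hecke's zeta-functions*, in Cassels–Fröhlich (1967), §2.1 (normalised absolute value).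
-/

set_option autoImplicit false

noncomputable section

open NumberField IsDedekindDomain
open scoped Matrix MatrixGroups NNReal ENNReal

namespace Literature.NumberTheory.Rogawski1990

open Literature.NumberTheory.Automorphic Literature.NumberTheory.GaloisRepresentations
open Literature.NumberTheory.GaloisRepresentations.IsNonarchimedeanLocalField

/-! ## §1 `‖·‖ = normAbs` on `K_v` -/

section Bridge

variable {K : Type} [Field K] [NumberField K]

/-- **Mathlib's norm on `K_v` is the normalised absolute value** `normAbs` of the local field `K_v` (both are `q_v^{−v(x)}`:
`FinitePlace.norm_def` and ★ `normAbs_eq_inv_zpow_of_valued_eq`); the tree's ★ `norm_eq_coe_normAbs` reproduced with a small import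
closure. [cite: TateThesis1967, §2.1] -/
private theorem norm_eq_coe_normAbs_adicCompletion (v : HeightOneSpectrum (𝓞 K)) (x : v.adicCompletion K) :
    ‖x‖ = ((normAbs (v.adicCompletion K) x : ℝ≥0) : ℝ) := by
  by_cases hx : x = 0
  · rw [hx, norm_zero, map_zero, NNReal.coe_zero]
  have hv : Valued.v x ≠ 0 := (Valuation.ne_zero_iff _).2 hx
  have hxn : Valued.v x = WithZero.exp (Multiplicative.toAdd (WithZero.unzero hv)) := by
    rw [WithZero.exp, ofAdd_toAdd, WithZero.coe_unzero]
  rw [FinitePlace.norm_def, WithZeroMulInt.toNNReal_neg_apply _ hv,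
    normAbs_eq_inv_zpow_of_valued_eq v hxn, residueFieldCard_adicCompletion_eq, inv_zpow', neg_neg]
  rfl

end Bridge


/-! ## §2 The scalar identity by name -/

section Split

variable (L : Type) [Field L] [NumberField L] [IsCMField L] (v : HeightOneSpectrum (𝓞 ↥(maximalRealSubfield L)))
  (a : (UnitaryGroup.cmDatum L 2 (Matrix.of fun i j : Fin 2 => if i.val + j.val + 1 = 2 then (1 : L) else 0)).Local v ×
      (UnitaryGroup.cmDatum L 1 (Matrix.of fun i j : Fin 1 => if i.val + j.val + 1 = 1 then (1 : L) else 0)).Local v)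
  (w : UnitaryGroup.PlacesOver L v) (H' : Matrix (Fin 3) (Fin 3) L)
  {n : Type*} [Fintype n] [DecidableEq n] {c' : n → Bool} (m : Π b, GL {i // c' i = b} (w.1.adicCompletion L))
  (eI : {i : n // c' i = false} ≃ Fin 2) (j₀ : {j : n // c' j = true}) (hj₀ : ∀ j : {j : n // c' j = true}, j = j₀)

include hj₀ in
/-- **`Δ‴_v(γ_H, γ′) · w(p) = C · τ_v(γ_H) · ‖det K_p‖_w^{1∕2}` at a split place.**  For `γ_H = a ∈ H_v`, a match `γ′ = b ∈ U(H′)_v`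
(`IsLocalNormPair`), `χ_g(u)` a unit, and a two-block Levi element `p = diag(m false, m true) ∈ P_{c′} ⊂ GL_n(L_w)` whose blocks are
`(g_w, u_w)` up to the relabelling `eI` (`hg`, `ht`, as in ★ `finWeylRatio_eq_boxAd_of_split`): with `K_p` the D-S1 box of `p`, any
`C : ℝ≥0∞`, and `τ_v(γ_H) = χ`,
`finExplicitDelta … a μ b · (C · ‖det(1 − K_p)‖⁻¹ · ‖det K_p‖).toReal = C.toReal · χ · √‖det K_p‖`
— ★ `finExplicitDelta_eq_tau_mul_weyl_of_split` × ★ `finWeylRatio_eq_boxAd_of_split` × ★ `delta_mul_w_eq_psi`, with `‖·‖_w = normAbs L_w`.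
This is the input `hA2` of ★ `classOrbital_pair_identity_of_sides` for `ψ(p_M) := C.toReal · χ(p_M) · ‖det K_{p_M}‖^{1∕2}`.
[cite: Rogawski1990, §4.9 p. 55; §4.13 Lemma 4.13.1 (a) pp. 64–66; §14.6 p. 242] -/
theorem finExplicitDelta_mul_toReal_eq_of_split (hw : IsCMField.complexConj L • w.1 ≠ w.1) (μ : HeckeCharacter L)
    {b : (UnitaryGroup.cmDatum L 3 H').Local v} (h : IsLocalNormPair L H' v a b)
    (hu : IsUnit ((finCharpolyTwo L v a).eval (finGammaTwo L v a)))
    (hg : Matrix.reindex eI eI ((m false : GL {i : n // c' i = false} (w.1.adicCompletion L)) : Matrix _ _ (w.1.adicCompletion L)) =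
      (a.1.val.val : Matrix (Fin 2) (Fin 2) (UnitaryGroup.LocalRing L v)).map (fun x => x w))
    (ht : ((m true : GL {j : n // c' j = true} (w.1.adicCompletion L)) : Matrix _ _ (w.1.adicCompletion L)) j₀ j₀ = finGammaTwo L v a w)
    (h1 : (1 - Matrix.of fun q q' : {i : n // c' i = false} × {j : n // c' j = true} =>
          (((leviEmbeddingP (w.1.adicCompletion L) c' m : standardParabolicGL (w.1.adicCompletion L) c') : GL n (w.1.adicCompletion L)) :
              Matrix n n (w.1.adicCompletion L)) q.1 q'.1 *
            ((((leviEmbeddingP (w.1.adicCompletion L) c' m)⁻¹ : standardParabolicGL (w.1.adicCompletion L) c') : GL n (w.1.adicCompletion L)) :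
              Matrix n n (w.1.adicCompletion L)) q'.2 q.2).det ≠ 0)
    (C : ℝ≥0∞) {χ : ℂ} (hτ : finTau L v a μ = χ) :
    finExplicitDelta L v H' a μ b *
        (((C * ((((normAbs (w.1.adicCompletion L) ((1 - Matrix.of fun q q' : {i : n // c' i = false} × {j : n // c' j = true} =>
            (((leviEmbeddingP (w.1.adicCompletion L) c' m : standardParabolicGL (w.1.adicCompletion L) c') : GL n (w.1.adicCompletion L)) :
                Matrix n n (w.1.adicCompletion L)) q.1 q'.1 *
              ((((leviEmbeddingP (w.1.adicCompletion L) c' m)⁻¹ : standardParabolicGL (w.1.adicCompletion L) c') : GL n (w.1.adicCompletion L)) :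
                Matrix n n (w.1.adicCompletion L)) q'.2 q.2).det))⁻¹ *
          normAbs (w.1.adicCompletion L) ((Matrix.of fun q q' : {i : n // c' i = false} × {j : n // c' j = true} =>
            (((leviEmbeddingP (w.1.adicCompletion L) c' m : standardParabolicGL (w.1.adicCompletion L) c') : GL n (w.1.adicCompletion L)) :
                Matrix n n (w.1.adicCompletion L)) q.1 q'.1 *
              ((((leviEmbeddingP (w.1.adicCompletion L) c' m)⁻¹ : standardParabolicGL (w.1.adicCompletion L) c') : GL n (w.1.adicCompletion L)) :
                Matrix n n (w.1.adicCompletion L)) q'.2 q.2).det) : ℝ≥0) : ℝ≥0∞))).toReal : ℝ) : ℂ) =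
      (C.toReal : ℂ) * χ *
        (Real.sqrt ‖(Matrix.of fun q q' : {i : n // c' i = false} × {j : n // c' j = true} =>
            (((leviEmbeddingP (w.1.adicCompletion L) c' m : standardParabolicGL (w.1.adicCompletion L) c') : GL n (w.1.adicCompletion L)) :
                Matrix n n (w.1.adicCompletion L)) q.1 q'.1 *
              ((((leviEmbeddingP (w.1.adicCompletion L) c' m)⁻¹ : standardParabolicGL (w.1.adicCompletion L) c') : GL n (w.1.adicCompletion L)) :
                Matrix n n (w.1.adicCompletion L)) q'.2 q.2).det‖ : ℂ) := by
  -- abbreviate the two determinants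
  set K : Matrix ({i : n // c' i = false} × {j : n // c' j = true}) ({i : n // c' i = false} × {j : n // c' j = true})
      (w.1.adicCompletion L) := Matrix.of fun q q' : {i : n // c' i = false} × {j : n // c' j = true} =>
    (((leviEmbeddingP (w.1.adicCompletion L) c' m : standardParabolicGL (w.1.adicCompletion L) c') : GL n (w.1.adicCompletion L)) :
        Matrix n n (w.1.adicCompletion L)) q.1 q'.1 *
      ((((leviEmbeddingP (w.1.adicCompletion L) c' m)⁻¹ : standardParabolicGL (w.1.adicCompletion L) c') : GL n (w.1.adicCompletion L)) :
        Matrix n n (w.1.adicCompletion L)) q'.2 q.2 with hK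
  have hK0 : K.det ≠ 0 := by
    rw [hK]; exact det_boxAd_ne_zero (w.1.adicCompletion L) c' (leviEmbeddingP (w.1.adicCompletion L) c' m)
  have hD := finWeylRatio_eq_boxAd_of_split L v a w m eI j₀ hj₀ hw hg ht
  rw [← hK] at hD
  have hΔ := finExplicitDelta_eq_tau_mul_weyl_of_split L v a w H' hw μ h hu
  -- norms
  have hd₁ : ‖(1 - K).det‖ ≠ 0 := norm_ne_zero_iff.2 h1
  have hdK : 0 < ‖K.det‖ := norm_pos_iff.2 hK0
  have hn1 : ((normAbs (w.1.adicCompletion L) ((1 - K).det) : ℝ≥0) : ℝ) = ‖(1 - K).det‖ :=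
    (norm_eq_coe_normAbs_adicCompletion w.1 _).symm
  have hnK : ((normAbs (w.1.adicCompletion L) K.det : ℝ≥0) : ℝ) = ‖K.det‖ :=
    (norm_eq_coe_normAbs_adicCompletion w.1 _).symm
  have hn10 : (normAbs (w.1.adicCompletion L) ((1 - K).det) : ℝ≥0) ≠ 0 := by
    intro h0; apply hd₁; rw [← hn1, h0, NNReal.coe_zero]
  have hwp : ((C * (((normAbs (w.1.adicCompletion L) ((1 - K).det))⁻¹ *
      normAbs (w.1.adicCompletion L) K.det : ℝ≥0) : ℝ≥0∞)).toReal : ℝ) =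
      C.toReal * ‖(1 - K).det‖⁻¹ * ‖K.det‖ := by
    rw [ENNReal.toReal_mul, ENNReal.coe_toReal, NNReal.coe_mul, NNReal.coe_inv, hn1, hnK, mul_assoc]
  exact delta_mul_w_eq_psi (Δ := finExplicitDelta L v H' a μ b) (τ := finTau L v a μ) (χ := χ)
    (D := finWeylRatio L v a) (d₁ := ‖(1 - K).det‖) (dK := ‖K.det‖) (C := C.toReal) hΔ hD hτ hwp rfl hd₁ hdK

end Split

end Literature.NumberTheory.Rogawski1990

end

/-! # ED. 2 — B5-A PART 2 (b): the instantiation (B-p12 (g27); LEAD F0P3a-plan (g8) T7-68 ∕ T7-76)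

APPEND-ONLY edition: everything above is PART 2 (a) byte-identical; below, the N6 split clause `isLocalDeltaTransferExists_finExplicit_of_split`
assembled from ★ B5-L, ★ B5-R, ★ PART 2 (a) + ★ B6, ★ (A1), ★ ψ-RIDERS, ★ A-p16 (l1)(l2), ★ B4″, ★ g0, over ★ PART 1 (P2)+(G1).  One theorem carries
`set_option maxHeartbeats 800000`: it is a single 60-binder assembly (≈ 28 s elaboration, no search tactics; 400 000 does not suffice) — the budget goes
to definitional unfolding of the `cmDatum`∕`«local»` carrier identifications at the ★ B5-R ∕ ★ B5-L junctions. -/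

noncomputable section

open MeasureTheory Measure Set Filter Topology NumberField IsDedekindDomain Literature.MeasureTheory.Group
open scoped ENNReal NNReal Matrix MatrixGroups

namespace Literature.NumberTheory.Rogawski1990

open Literature.NumberTheory.Automorphic Literature.NumberTheory.Automorphic.UnitaryGroup
open Literature.NumberTheory.GaloisRepresentations Literature.NumberTheory.GaloisRepresentations.IsNonarchimedeanLocalField

/-- The `(2,1)` block labelling of `GL₃` is monotone. [cite: BernsteinZelevinsky1977, §2.1] -/
theorem monotone_twoOneLabel : Monotone (fun i : Fin (2 + 1) => decide (2 ≤ (i : ℕ))) := by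
  intro i j hij
  fin_cases i <;> fin_cases j <;> simp_all

/-! ## §4 (ED. 2) B5-A PART 2 (b): the local `Δ‴_v`-transfer EXISTS at a split place (N6, split clause) -/

section PartTwoB

variable (L : Type) [Field L] [NumberField L] [IsCMField L] (H' : Matrix (Fin 3) (Fin 3) L)
  {v : HeightOneSpectrum (𝓞 ↥(maximalRealSubfield L))} (hc : IsCMField.complexConj L ≠ 1)
  (w : UnitaryGroup.PlacesOver L v) (hw : IsCMField.complexConj L • w.1 ≠ w.1)
  (hΦ₂ : ((Matrix.of fun i j : Fin 2 => if i.val + j.val + 1 = 2 then (1 : L) else 0).map (IsCMField.complexConj L))ᵀ =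
    Matrix.of fun i j : Fin 2 => if i.val + j.val + 1 = 2 then (1 : L) else 0)
  (hΦ₂w : IsUnit (placeForm (Matrix.of fun i j : Fin 2 => if i.val + j.val + 1 = 2 then (1 : L) else 0) w.1))
  (hΦ₁ : ((Matrix.of fun i j : Fin 1 => if i.val + j.val + 1 = 1 then (1 : L) else 0).map (IsCMField.complexConj L))ᵀ =
    Matrix.of fun i j : Fin 1 => if i.val + j.val + 1 = 1 then (1 : L) else 0)
  (hΦ₁w : IsUnit (placeForm (Matrix.of fun i j : Fin 1 => if i.val + j.val + 1 = 1 then (1 : L) else 0) w.1))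
  (hH' : (H'.map (IsCMField.complexConj L))ᵀ = H') (hH'w : IsUnit (placeForm H' w.1))

include hc hw hΦ₂ hΦ₂w hΦ₁ hΦ₁w hH' hH'w in
set_option maxHeartbeats 800000 in
/-- **[Rogawski1990, Prop. 4.9.1 (a)] — THE SPLIT-PLACE CLAUSE OF N6: the local `Δ‴_v`-transfer `φ ↦ φ^H` EXISTS at a place `v` of `L⁺`
split in `L`, for CANONICAL orbital measure families.**  For every `φ ∈ C_c^∞(U(H′)(L⁺_v))` the function
`φ^H := (ψ · (φ ∘ e′⁻¹)^{(P)}) ∘ j̃ ∈ C_c^∞(H_v)` — the constant term along the `(2,1)`-parabolic of `GL₃(L_w)` of `φ` read on `GL₃(L_w)`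
(`e′ = localSplitEquiv`), weighted by `ψ(m) = C · μ_w(det m₂) · ‖det K_m‖_w^{1∕2}` and pulled back along `j̃ : H_v ≃ GL₂(L_w) × GL₁(L_w) ≃ M_{(2,1)}`
— satisfies `Φ^{st}(γ_H, φ^H) = Σ_{[γ]} Δ‴_v(γ_H, γ) Φ([γ], φ)` at every `G`-regular `γ_H` (★ `IsLocalDeltaTransferExists` at ★ `finExplicitCollection`).
Assembly (★ `isLocalDeltaTransferExists_of_split_of_forall_pair`) of: the `H`-side ★ B5-L `classOrbitalIntegral_eq_mul_orbitalIntegral_of_isCanonical_of_eq`,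
the `G`-side ★ B5-R `exists_classOrbitalIntegral_eq_smul_orbitalIntegral_levi_of_split` (Lemma 4.13.1 (a)), the scalar identity ★ PART 2 (a)
`finExplicitDelta_mul_toReal_eq_of_split` with ★ B6 `finTau_eq_localComponent_det_of_split` (guard `hdual`), the test-function class ★ (A1)
`isLocSmooth_mul_constantTerm_comp_twoOne`, the frames ★ A-p16 `exists_continuousMulEquiv_prod_standardLeviGL_twoBlock` ∕ ★ B4″
`exists_eq_leviEmbeddingP_blocks`, and ONE canonically normalised torus measure per Levi point ★ `exists_isHaarMeasure_compactCore_centralizer_subgroup_eq_one`.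
[cite: Rogawski1990, §4.9 Prop. 4.9.1 (a) pp. 54–55; §4.13 Lemma 4.13.1 (a) pp. 64–66; §4.3 (4.3.1) p. 43] [cite: LanglandsShelstad1987, §1] -/
theorem isLocalDeltaTransferExists_finExplicit_of_split
    (hΦ₂' : ((Matrix.of fun i j : Fin 2 => if i.val + j.val + 1 = 2 then (1 : L) else 0).map (cmConjRingHom L))ᵀ =
      Matrix.of fun i j : Fin 2 => if i.val + j.val + 1 = 2 then (1 : L) else 0)
    (hΦ₂d : (Matrix.of fun i j : Fin 2 => if i.val + j.val + 1 = 2 then (1 : L) else 0).det ≠ 0)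
    (hΦ₁' : ((Matrix.of fun i j : Fin 1 => if i.val + j.val + 1 = 1 then (1 : L) else 0).map (cmConjRingHom L))ᵀ =
      Matrix.of fun i j : Fin 1 => if i.val + j.val + 1 = 1 then (1 : L) else 0)
    (hΦ₁d : (Matrix.of fun i j : Fin 1 => if i.val + j.val + 1 = 1 then (1 : L) else 0).det ≠ 0)
    [MeasurableSpace (w.1.adicCompletion L)] [BorelSpace (w.1.adicCompletion L)]
    [MeasurableSpace ((UnitaryGroup.cmDatum L 2 (Matrix.of fun i j : Fin 2 => if i.val + j.val + 1 = 2 then (1 : L) else 0)).Local v ×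
        (UnitaryGroup.cmDatum L 1 (Matrix.of fun i j : Fin 1 => if i.val + j.val + 1 = 1 then (1 : L) else 0)).Local v)]
    [BorelSpace ((UnitaryGroup.cmDatum L 2 (Matrix.of fun i j : Fin 2 => if i.val + j.val + 1 = 2 then (1 : L) else 0)).Local v ×
        (UnitaryGroup.cmDatum L 1 (Matrix.of fun i j : Fin 1 => if i.val + j.val + 1 = 1 then (1 : L) else 0)).Local v)]
    [MeasurableSpace ((UnitaryGroup.cmDatum L 3 H').Local v)] [BorelSpace ((UnitaryGroup.cmDatum L 3 H').Local v)]
    [∀ a : ((UnitaryGroup.cmDatum L 2 (Matrix.of fun i j : Fin 2 => if i.val + j.val + 1 = 2 then (1 : L) else 0)).Local v ×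
        (UnitaryGroup.cmDatum L 1 (Matrix.of fun i j : Fin 1 => if i.val + j.val + 1 = 1 then (1 : L) else 0)).Local v),
      MeasurableSpace (((UnitaryGroup.cmDatum L 2 (Matrix.of fun i j : Fin 2 => if i.val + j.val + 1 = 2 then (1 : L) else 0)).Local v ×
        (UnitaryGroup.cmDatum L 1 (Matrix.of fun i j : Fin 1 => if i.val + j.val + 1 = 1 then (1 : L) else 0)).Local v) ⧸
        Subgroup.centralizer ({a} : Set ((UnitaryGroup.cmDatum L 2 (Matrix.of fun i j : Fin 2 => if i.val + j.val + 1 = 2 then (1 : L) else 0)).Local v ×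
        (UnitaryGroup.cmDatum L 1 (Matrix.of fun i j : Fin 1 => if i.val + j.val + 1 = 1 then (1 : L) else 0)).Local v)))]
    [∀ a : ((UnitaryGroup.cmDatum L 2 (Matrix.of fun i j : Fin 2 => if i.val + j.val + 1 = 2 then (1 : L) else 0)).Local v ×
        (UnitaryGroup.cmDatum L 1 (Matrix.of fun i j : Fin 1 => if i.val + j.val + 1 = 1 then (1 : L) else 0)).Local v),
      BorelSpace (((UnitaryGroup.cmDatum L 2 (Matrix.of fun i j : Fin 2 => if i.val + j.val + 1 = 2 then (1 : L) else 0)).Local v ×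
        (UnitaryGroup.cmDatum L 1 (Matrix.of fun i j : Fin 1 => if i.val + j.val + 1 = 1 then (1 : L) else 0)).Local v) ⧸
        Subgroup.centralizer ({a} : Set ((UnitaryGroup.cmDatum L 2 (Matrix.of fun i j : Fin 2 => if i.val + j.val + 1 = 2 then (1 : L) else 0)).Local v ×
        (UnitaryGroup.cmDatum L 1 (Matrix.of fun i j : Fin 1 => if i.val + j.val + 1 = 1 then (1 : L) else 0)).Local v)))]
    [∀ γ : (UnitaryGroup.cmDatum L 3 H').Local v,
      MeasurableSpace ((UnitaryGroup.cmDatum L 3 H').Local v ⧸ Subgroup.centralizer ({γ} : Set ((UnitaryGroup.cmDatum L 3 H').Local v)))]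
    [∀ γ : (UnitaryGroup.cmDatum L 3 H').Local v,
      BorelSpace ((UnitaryGroup.cmDatum L 3 H').Local v ⧸ Subgroup.centralizer ({γ} : Set ((UnitaryGroup.cmDatum L 3 H').Local v)))]
    (μ : HeckeCharacter L)
    (hl : ∀ (v : HeightOneSpectrum (𝓞 ↥(maximalRealSubfield L)))
      (a : (UnitaryGroup.cmDatum L 2 (Matrix.of fun i j : Fin 2 => if i.val + j.val + 1 = 2 then (1 : L) else 0)).Local v ×
      (UnitaryGroup.cmDatum L 1 (Matrix.of fun i j : Fin 1 => if i.val + j.val + 1 = 1 then (1 : L) else 0)).Local v)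
      (b : (UnitaryGroup.cmDatum L 3 H').Local v)
      (x : (UnitaryGroup.cmDatum L 2 (Matrix.of fun i j : Fin 2 => if i.val + j.val + 1 = 2 then (1 : L) else 0)).Local v ×
      (UnitaryGroup.cmDatum L 1 (Matrix.of fun i j : Fin 1 => if i.val + j.val + 1 = 1 then (1 : L) else 0)).Local v),
      finExplicitDelta L v H' (x * a * x⁻¹) μ b = finExplicitDelta L v H' a μ b)
    (hr : ∀ (v : HeightOneSpectrum (𝓞 ↥(maximalRealSubfield L)))
      (a : (UnitaryGroup.cmDatum L 2 (Matrix.of fun i j : Fin 2 => if i.val + j.val + 1 = 2 then (1 : L) else 0)).Local v ×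
      (UnitaryGroup.cmDatum L 1 (Matrix.of fun i j : Fin 1 => if i.val + j.val + 1 = 1 then (1 : L) else 0)).Local v)
      (b y : (UnitaryGroup.cmDatum L 3 H').Local v),
      finExplicitDelta L v H' a μ (y * b * y⁻¹) = finExplicitDelta L v H' a μ b)
    (hdual : HeckeCharacter.galConj (IsCMField.complexConj L) μ = μ⁻¹)
    (νH : Measure ((UnitaryGroup.cmDatum L 2 (Matrix.of fun i j : Fin 2 => if i.val + j.val + 1 = 2 then (1 : L) else 0)).Local v ×
        (UnitaryGroup.cmDatum L 1 (Matrix.of fun i j : Fin 1 => if i.val + j.val + 1 = 1 then (1 : L) else 0)).Local v))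
    [νH.IsHaarMeasure] [νH.IsMulRightInvariant]
    (νG : Measure ((UnitaryGroup.cmDatum L 3 H').Local v)) [νG.IsHaarMeasure] [νG.IsMulRightInvariant]
    (mH : OrbitalMeasureFamily ((UnitaryGroup.cmDatum L 2 (Matrix.of fun i j : Fin 2 => if i.val + j.val + 1 = 2 then (1 : L) else 0)).Local v ×
        (UnitaryGroup.cmDatum L 1 (Matrix.of fun i j : Fin 1 => if i.val + j.val + 1 = 1 then (1 : L) else 0)).Local v))
    (mG : OrbitalMeasureFamily ((UnitaryGroup.cmDatum L 3 H').Local v))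
    (hcanH : mH.IsCanonical (IsLocalGRegular L v) νH)
    (hcanG : mG.IsCanonical (fun γ : (UnitaryGroup.cmDatum L 3 H').Local v => IsRegularElt (γ.val : GL (Fin 3) (UnitaryGroup.LocalRing L v))) νG) :
    IsLocalDeltaTransferExists L H' v (finExplicitCollection L H' μ hl hr v) mH mG IsLocSmooth IsLocSmooth := by
  -- (0) the `G′_v` carrier under its `«local»` name (★ `cmDatum_Local`, definitional) for the instance binders of ★ B5-R
  letI : MeasurableSpace ↥(«local» L (IsCMField.complexConj L) 3 H' v) := ‹MeasurableSpace ((UnitaryGroup.cmDatum L 3 H').Local v)›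
  haveI : @BorelSpace ↥(«local» L (IsCMField.complexConj L) 3 H' v) _ ‹MeasurableSpace ((UnitaryGroup.cmDatum L 3 H').Local v)› :=
    ‹BorelSpace ((UnitaryGroup.cmDatum L 3 H').Local v)›
  letI : ∀ γ : ↥(«local» L (IsCMField.complexConj L) 3 H' v),
      MeasurableSpace (↥(«local» L (IsCMField.complexConj L) 3 H' v) ⧸ Subgroup.centralizer ({γ} : Set ↥(«local» L (IsCMField.complexConj L) 3 H' v))) :=
    ‹∀ γ : (UnitaryGroup.cmDatum L 3 H').Local v,
      MeasurableSpace ((UnitaryGroup.cmDatum L 3 H').Local v ⧸ Subgroup.centralizer ({γ} : Set ((UnitaryGroup.cmDatum L 3 H').Local v)))›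
  haveI : ∀ γ : ↥(«local» L (IsCMField.complexConj L) 3 H' v),
      @BorelSpace (↥(«local» L (IsCMField.complexConj L) 3 H' v) ⧸ Subgroup.centralizer ({γ} : Set ↥(«local» L (IsCMField.complexConj L) 3 H' v))) _
        (‹∀ γ : (UnitaryGroup.cmDatum L 3 H').Local v,
          MeasurableSpace ((UnitaryGroup.cmDatum L 3 H').Local v ⧸ Subgroup.centralizer ({γ} : Set ((UnitaryGroup.cmDatum L 3 H').Local v)))› γ) :=
    ‹∀ γ : (UnitaryGroup.cmDatum L 3 H').Local v,
      BorelSpace ((UnitaryGroup.cmDatum L 3 H').Local v ⧸ Subgroup.centralizer ({γ} : Set ((UnitaryGroup.cmDatum L 3 H').Local v)))›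
  haveI : (show Measure ↥(«local» L (IsCMField.complexConj L) 3 H' v) from νG).IsHaarMeasure := ‹νG.IsHaarMeasure›
  haveI : (show Measure ↥(«local» L (IsCMField.complexConj L) 3 H' v) from νG).IsMulRightInvariant := ‹νG.IsMulRightInvariant›
  -- (0) instances on `GL₃(L_w)`, the Levi `M`, `K`, `U`
  letI : MeasurableSpace (GL (Fin (2 + 1)) (w.1.adicCompletion L)) := borel _
  haveI : BorelSpace (GL (Fin (2 + 1)) (w.1.adicCompletion L)) := ⟨rfl⟩
  haveI : LocallyCompactSpace (GL (Fin (2 + 1)) (w.1.adicCompletion L)) := locallyCompactSpace_gl_adicCompletion L (2 + 1) w.1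
  haveI : SecondCountableTopology (GL (Fin (2 + 1)) (w.1.adicCompletion L)) := secondCountableTopology_gl_adicCompletion L (2 + 1) w.1
  have hMc : IsClosed ((standardLeviGL (w.1.adicCompletion L) (fun i : Fin (2 + 1) => decide (2 ≤ (i : ℕ))) :
      Subgroup (GL (Fin (2 + 1)) (w.1.adicCompletion L))) : Set (GL (Fin (2 + 1)) (w.1.adicCompletion L))) :=
    isClosed_standardLeviGL (R := w.1.adicCompletion L) _
  haveI : LocallyCompactSpace ↥(standardLeviGL (w.1.adicCompletion L) (fun i : Fin (2 + 1) => decide (2 ≤ (i : ℕ)))) :=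
    hMc.isClosedEmbedding_subtypeVal.locallyCompactSpace
  haveI : BorelSpace ↥(standardLeviGL (w.1.adicCompletion L) (fun i : Fin (2 + 1) => decide (2 ≤ (i : ℕ)))) := Subtype.borelSpace _
  letI : MeasurableSpace (GL (Fin (2 + 1)) (w.1.adicCompletion L) ⧸ standardLeviGL (w.1.adicCompletion L) (fun i : Fin (2 + 1) => decide (2 ≤ (i : ℕ)))) :=
    borel _
  haveI : BorelSpace (GL (Fin (2 + 1)) (w.1.adicCompletion L) ⧸ standardLeviGL (w.1.adicCompletion L) (fun i : Fin (2 + 1) => decide (2 ≤ (i : ℕ)))) := ⟨rfl⟩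
  letI : ∀ m : ↥(standardLeviGL (w.1.adicCompletion L) (fun i : Fin (2 + 1) => decide (2 ≤ (i : ℕ)))),
      MeasurableSpace (↥(standardLeviGL (w.1.adicCompletion L) (fun i : Fin (2 + 1) => decide (2 ≤ (i : ℕ)))) ⧸
        Subgroup.centralizer ({m} : Set ↥(standardLeviGL (w.1.adicCompletion L) (fun i : Fin (2 + 1) => decide (2 ≤ (i : ℕ)))))) :=
    fun _ => borel _
  haveI : ∀ m : ↥(standardLeviGL (w.1.adicCompletion L) (fun i : Fin (2 + 1) => decide (2 ≤ (i : ℕ)))),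
      BorelSpace (↥(standardLeviGL (w.1.adicCompletion L) (fun i : Fin (2 + 1) => decide (2 ≤ (i : ℕ)))) ⧸
        Subgroup.centralizer ({m} : Set ↥(standardLeviGL (w.1.adicCompletion L) (fun i : Fin (2 + 1) => decide (2 ≤ (i : ℕ)))))) :=
    fun _ => ⟨rfl⟩
  haveI : BorelSpace ↥(glInt (2 + 1) (w.1.adicCompletion L)) := Subtype.borelSpace _
  haveI : CompactSpace ↥(glInt (2 + 1) (w.1.adicCompletion L)) := isCompact_iff_compactSpace.1 (isCompact_glInt (2 + 1) (w.1.adicCompletion L))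
  haveI : BorelSpace ↥(unipotentRadicalGL (w.1.adicCompletion L) (fun i : Fin (2 + 1) => decide (2 ≤ (i : ℕ)))) := Subtype.borelSpace _
  haveI : LocallyCompactSpace ↥(unipotentRadicalGL (w.1.adicCompletion L) (fun i : Fin (2 + 1) => decide (2 ≤ (i : ℕ)))) :=
    (isClosed_unipotentRadicalGL (R := w.1.adicCompletion L) (fun i : Fin (2 + 1) => decide (2 ≤ (i : ℕ)))).isClosedEmbedding_subtypeVal.locallyCompactSpace
  haveI : SecondCountableTopology ↥(unipotentRadicalGL (w.1.adicCompletion L) (fun i : Fin (2 + 1) => decide (2 ≤ (i : ℕ)))) :=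
    TopologicalSpace.Subtype.secondCountableTopology _
  obtain ⟨κ, hκ⟩ : ∃ κ : Measure ↥(glInt (2 + 1) (w.1.adicCompletion L)), IsHaarMeasure κ := ⟨Measure.haar, inferInstance⟩
  haveI := hκ
  obtain ⟨μU, hμU⟩ : ∃ μU : Measure ↥(unipotentRadicalGL (w.1.adicCompletion L) (fun i : Fin (2 + 1) => decide (2 ≤ (i : ℕ)))), IsHaarMeasure μU :=
    ⟨Measure.haar, inferInstance⟩
  haveI := hμU
  haveI : SFinite μU := inferInstance
  -- (1) the frames `e′`, `e₂`, `e₁`, `eM` (kept OPAQUE with their defining equations) and `j̃ : H_v ≃ₜ* M`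
  obtain ⟨e', he'⟩ : ∃ e' : ↥(«local» L (IsCMField.complexConj L) 3 H' v) ≃ₜ* GL (Fin 3) (w.1.adicCompletion L),
      e' = localSplitEquiv (IsCMField.complexConj L) H' hc hH' w hw hH'w := ⟨_, rfl⟩
  obtain ⟨e₂, he₂⟩ : ∃ e₂ : ↥(«local» L (IsCMField.complexConj L) 2 (Matrix.of fun i j : Fin 2 => if i.val + j.val + 1 = 2 then (1 : L) else 0) v) ≃ₜ*
      GL (Fin 2) (w.1.adicCompletion L),
      e₂ = localSplitEquiv (IsCMField.complexConj L) (Matrix.of fun i j : Fin 2 => if i.val + j.val + 1 = 2 then (1 : L) else 0) hc hΦ₂ w hw hΦ₂w :=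
    ⟨_, rfl⟩
  obtain ⟨e₁, he₁⟩ : ∃ e₁ : ↥(«local» L (IsCMField.complexConj L) 1 (Matrix.of fun i j : Fin 1 => if i.val + j.val + 1 = 1 then (1 : L) else 0) v) ≃ₜ*
      GL (Fin 1) (w.1.adicCompletion L),
      e₁ = localSplitEquiv (IsCMField.complexConj L) (Matrix.of fun i j : Fin 1 => if i.val + j.val + 1 = 1 then (1 : L) else 0) hc hΦ₁ w hw hΦ₁w :=
    ⟨_, rfl⟩
  obtain ⟨eM, heM⟩ := exists_continuousMulEquiv_prod_standardLeviGL_twoBlock (w.1.adicCompletion L) 2 1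
  let jj : ((UnitaryGroup.cmDatum L 2 (Matrix.of fun i j : Fin 2 => if i.val + j.val + 1 = 2 then (1 : L) else 0)).Local v ×
        (UnitaryGroup.cmDatum L 1 (Matrix.of fun i j : Fin 1 => if i.val + j.val + 1 = 1 then (1 : L) else 0)).Local v) ≃ₜ*
      ↥(standardLeviGL (w.1.adicCompletion L) (fun i : Fin (2 + 1) => decide (2 ≤ (i : ℕ)))) :=
    { toMulEquiv := (MulEquiv.prodCongr e₂.toMulEquiv e₁.toMulEquiv).trans eM.toMulEquiv
      continuous_toFun := eM.continuous.comp (e₂.continuous.prodMap e₁.continuous)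
      continuous_invFun := (e₂.symm.continuous.prodMap e₁.symm.continuous).comp eM.symm.continuous }
  have hjj : ∀ x, jj x = eM (e₂ x.1, e₁ x.2) := fun _ => rfl
  -- (2) measures: `ν_M := j̃_* ν_H`
  haveI : νH.IsInvInvariant := isInvInvariant_of_isMulRightInvariant νH
  haveI : IsHaarMeasure (Measure.map jj νH) := jj.isHaarMeasure_map νH
  haveI : (Measure.map jj νH).IsMulRightInvariant :=
    isMulRightInvariant_map_mulEquiv_of_isMulRightInvariant jj.toMulEquiv jj.continuous.measurable νH
  haveI : (Measure.map jj νH).IsInvInvariant := isInvInvariant_map_mulEquiv jj.toMulEquiv jj.continuous.measurable νH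
  -- (3) the `G`-side constant (★ B5-R)
  obtain ⟨C, -, -, hB⟩ := exists_classOrbitalIntegral_eq_smul_orbitalIntegral_levi_of_split (IsCMField.complexConj L) 3 H' hc hH' w hw hH'w
    νG mG (Measure.map jj νH) κ μU monotone_twoOneLabel hcanG
  -- (4) the weight `ψ` and the transfer map
  let ψ : ↥(standardLeviGL (w.1.adicCompletion L) (fun i : Fin (2 + 1) => decide (2 ≤ (i : ℕ)))) → ℂ := fun m =>
    (C.toReal : ℂ) *
        (fun u : (w.1.adicCompletion L)ˣ => ((μ.localComponent w.1 u : ℂˣ) : ℂ))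
          (Matrix.GeneralLinearGroup.det (leviProjection (w.1.adicCompletion L) (fun i : Fin (2 + 1) => decide (2 ≤ (i : ℕ)))
            ⟨(m : GL (Fin (2 + 1)) (w.1.adicCompletion L)), standardLeviGL_le (w.1.adicCompletion L) _ m.2⟩ false)) *
      ((Real.sqrt ((normAbs (w.1.adicCompletion L) (Matrix.of fun q q' : {i : Fin (2 + 1) // (fun i : Fin (2 + 1) => decide (2 ≤ (i : ℕ))) i = false} ×
            {j : Fin (2 + 1) // (fun i : Fin (2 + 1) => decide (2 ≤ (i : ℕ))) j = true} =>
          (((⟨(m : GL (Fin (2 + 1)) (w.1.adicCompletion L)), standardLeviGL_le (w.1.adicCompletion L) _ m.2⟩ :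
              ↥(standardParabolicGL (w.1.adicCompletion L) (fun i : Fin (2 + 1) => decide (2 ≤ (i : ℕ))))) :
              GL (Fin (2 + 1)) (w.1.adicCompletion L)) : Matrix (Fin (2 + 1)) (Fin (2 + 1)) (w.1.adicCompletion L)) q.1 q'.1 *
            ((((⟨(m : GL (Fin (2 + 1)) (w.1.adicCompletion L)), standardLeviGL_le (w.1.adicCompletion L) _ m.2⟩ :
              ↥(standardParabolicGL (w.1.adicCompletion L) (fun i : Fin (2 + 1) => decide (2 ≤ (i : ℕ)))))⁻¹ :
              standardParabolicGL (w.1.adicCompletion L) (fun i : Fin (2 + 1) => decide (2 ≤ (i : ℕ)))) :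
              GL (Fin (2 + 1)) (w.1.adicCompletion L)) : Matrix (Fin (2 + 1)) (Fin (2 + 1)) (w.1.adicCompletion L)) q'.2 q.2).det : ℝ≥0) : ℝ) : ℝ) : ℂ)
  let gφ : ((UnitaryGroup.cmDatum L 3 H').Local v → ℂ) →
      ↥(standardLeviGL (w.1.adicCompletion L) (fun i : Fin (2 + 1) => decide (2 ≤ (i : ℕ)))) → ℂ := fun φ m =>
    ∫ q' : ↥(glInt (2 + 1) (w.1.adicCompletion L)) × ↥(unipotentRadicalGL (w.1.adicCompletion L) (fun i : Fin (2 + 1) => decide (2 ≤ (i : ℕ)))),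
      φ (e'.symm ((q'.1 : GL (Fin (2 + 1)) (w.1.adicCompletion L)) * ((m : GL (Fin (2 + 1)) (w.1.adicCompletion L)) *
        (q'.2 : GL (Fin (2 + 1)) (w.1.adicCompletion L))) * (q'.1 : GL (Fin (2 + 1)) (w.1.adicCompletion L))⁻¹)) ∂(κ.prod μU)
  have hψconj : ∀ y m, ψ (y * m * y⁻¹) = ψ m := fun y m =>
    levi_weight_det_leviProjection_conj_eq (w.1.adicCompletion L) (fun i : Fin (2 + 1) => decide (2 ≤ (i : ℕ)))
      (fun u : (w.1.adicCompletion L)ˣ => ((μ.localComponent w.1 u : ℂˣ) : ℂ)) false (C.toReal : ℂ) m y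
  have hψlc : IsLocallyConstant ψ :=
    isLocallyConstant_levi_weight_det_leviProjection (w.1.adicCompletion L) (fun i : Fin (2 + 1) => decide (2 ≤ (i : ℕ)))
      (μ.isLocallyConstant_localComponent_coe w.1) false (C.toReal : ℂ)
  refine isLocalDeltaTransferExists_of_split_of_forall_pair L H' hc w hw hΦ₂ hΦ₂w hΦ₁ hΦ₁w hH' hH'w hΦ₂' hΦ₂d hΦ₁' hΦ₁d
    (finExplicitCollection L H' μ hl hr v) mH mG IsLocSmooth IsLocSmooth (fun φ h => ψ (jj h) * gφ φ (jj h)) ?_ ?_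
  · -- `φ^H ∈ C_c^∞(H_v)` (★ (A1))
    intro φ hφ
    exact isLocSmooth_mul_constantTerm_comp_twoOne (w.1.adicCompletion L) (κ.prod μU) (φ := fun y => φ (e'.symm y))
      (hφ.isLocallyConstant.comp_continuous e'.symm.continuous) (hφ.hasCompactSupport.comp_homeomorph e'.symm.toHomeomorph) hψlc jj
  · -- the identity per normalised matching pair `(γ_H, γ₀)`, `e′ γ₀ = endoGL (e₂ γ_H.1, e₁ γ_H.2)`
    intro φ hφ γH hreg γ₀ h₀ he
    rw [← he', ← he₂, ← he₁] at he
    -- (5) the Levi point `p = diag(e₂ γ_H.1, e₁ γ_H.2) = leviEmbeddingP c₀ m ∈ P ∩ M`, its conjugator `q`, regularity, the torus measure `ρ`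
    have hregGL : IsRegularElt (endoGL (e₂ γH.1, e₁ γH.2)) := by
      have h := isRegularElt_endoGL_of_isLocalGRegular_of_split L hc w hw hΦ₂ hΦ₂w hΦ₁ hΦ₁w γH hreg
      rwa [← he₂, ← he₁] at h
    have hdet : (((e₂ γH.1 : GL (Fin 2) (w.1.adicCompletion L)) : Matrix (Fin 2) (Fin 2) (w.1.adicCompletion L)) -
        (((e₁ γH.2 : GL (Fin 1) (w.1.adicCompletion L)) : Matrix (Fin 1) (Fin 1) (w.1.adicCompletion L)) 0 0) •
          (1 : Matrix (Fin 2) (Fin 2) (w.1.adicCompletion L))).det ≠ 0 :=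
      det_sub_ne_zero_of_isRegularElt_endoGL (e₂ γH.1) (e₁ γH.2) hregGL
    obtain ⟨m, eI, j₀, hj₀, -, hlev, hg0, ht0⟩ := exists_eq_leviEmbeddingP_blocks 2 (e₂ γH.1) (e₁ γH.2)
    have hpM : ((leviEmbeddingP (w.1.adicCompletion L) (fun i : Fin (2 + 1) => decide (2 ≤ (i : ℕ))) m :
        ↥(standardParabolicGL (w.1.adicCompletion L) (fun i : Fin (2 + 1) => decide (2 ≤ (i : ℕ))))) : GL (Fin (2 + 1)) (w.1.adicCompletion L)) ∈
          standardLeviGL (w.1.adicCompletion L) (fun i : Fin (2 + 1) => decide (2 ≤ (i : ℕ))) := ⟨m, rfl⟩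
    obtain ⟨q, hq⟩ := isConj_iff.1 (isConj_endoGL_reindexGL_blockDiagGL (e₂ γH.1, e₁ γH.2))
    have hq' : q * localSplitEquiv (IsCMField.complexConj L) H' hc hH' w hw hH'w γ₀ * q⁻¹ =
        ((leviEmbeddingP (w.1.adicCompletion L) (fun i : Fin (2 + 1) => decide (2 ≤ (i : ℕ))) m :
          ↥(standardParabolicGL (w.1.adicCompletion L) (fun i : Fin (2 + 1) => decide (2 ≤ (i : ℕ))))) : GL (Fin (2 + 1)) (w.1.adicCompletion L)) := by
      rw [← he', he, hq, hlev]
    have hTM : Subgroup.centralizer ({((leviEmbeddingP (w.1.adicCompletion L) (fun i : Fin (2 + 1) => decide (2 ≤ (i : ℕ))) m :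
          ↥(standardParabolicGL (w.1.adicCompletion L) (fun i : Fin (2 + 1) => decide (2 ≤ (i : ℕ))))) : GL (Fin (2 + 1)) (w.1.adicCompletion L))} :
          Set (GL (Fin (2 + 1)) (w.1.adicCompletion L))) ≤ standardLeviGL (w.1.adicCompletion L) (fun i : Fin (2 + 1) => decide (2 ≤ (i : ℕ))) := by
      rw [hlev]
      exact centralizer_le_standardLeviGL_of_det_sub_ne_zero 2 (e₂ γH.1) (e₁ γH.2) hdet
    have hp1 := det_one_sub_boxAd_ne_zero_of_det_sub_ne_zero 2 (e₂ γH.1) (e₁ γH.2) hdet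
      (leviEmbeddingP (w.1.adicCompletion L) (fun i : Fin (2 + 1) => decide (2 ≤ (i : ℕ))) m) hlev
    have hreg₀ : IsRegularElt (γ₀.val : GL (Fin 3) (UnitaryGroup.LocalRing L v)) := isRegularElt_of_isLocalNormPair L H' v h₀ hreg
    have hsep : (((⟨((leviEmbeddingP (w.1.adicCompletion L) (fun i : Fin (2 + 1) => decide (2 ≤ (i : ℕ))) m :
          ↥(standardParabolicGL (w.1.adicCompletion L) (fun i : Fin (2 + 1) => decide (2 ≤ (i : ℕ))))) : GL (Fin (2 + 1)) (w.1.adicCompletion L)), hpM⟩ :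
          ↥(standardLeviGL (w.1.adicCompletion L) (fun i : Fin (2 + 1) => decide (2 ≤ (i : ℕ))))) : GL (Fin (2 + 1)) (w.1.adicCompletion L)) :
            Matrix (Fin (2 + 1)) (Fin (2 + 1)) (w.1.adicCompletion L)).charpoly.Separable := by
      have h1 := (isRegularElt_conj_iff q (endoGL (e₂ γH.1, e₁ γH.2))).2 hregGL
      rw [hq, ← hlev] at h1
      exact h1
    obtain ⟨ρ, hρH, hρI, hρ1⟩ := exists_isHaarMeasure_compactCore_centralizer_subgroup_eq_one w.1
      (standardLeviGL (w.1.adicCompletion L) (fun i : Fin (2 + 1) => decide (2 ≤ (i : ℕ)))) hMc ⟨_, hpM⟩ hsep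
    haveI := hρH
    haveI := hρI
    -- (6) the `G`-side (★ B5-R)
    have hR := hB γ₀ hreg₀ (leviEmbeddingP (w.1.adicCompletion L) (fun i : Fin (2 + 1) => decide (2 ≤ (i : ℕ))) m) hpM q hq' hTM hp1 ρ hρ1 φ
      hφ.continuous hφ.hasCompactSupport
    rw [← he', map_inv₀ (normAbs (w.1.adicCompletion L))] at hR
    -- (7) the `H`-side (★ B5-L)
    have hjjp : jj.toMulEquiv γH = ⟨((leviEmbeddingP (w.1.adicCompletion L) (fun i : Fin (2 + 1) => decide (2 ≤ (i : ℕ))) m :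
        ↥(standardParabolicGL (w.1.adicCompletion L) (fun i : Fin (2 + 1) => decide (2 ≤ (i : ℕ))))) : GL (Fin (2 + 1)) (w.1.adicCompletion L)), hpM⟩ := by
      apply Subtype.ext
      show ((eM (e₂ γH.1, e₁ γH.2) : ↥(standardLeviGL (w.1.adicCompletion L) (fun i : Fin (2 + 1) => decide (2 ≤ (i : ℕ))))) :
        GL (Fin (2 + 1)) (w.1.adicCompletion L)) = _
      rw [heM, hlev]
    have hP : IsLocalGRegular L v (Quotient.out (ConjClasses.mk γH)) := isLocalGRegular_out_mk hreg
    have hL := classOrbitalIntegral_eq_mul_orbitalIntegral_of_isCanonical_of_eq jj.toMulEquiv jj.continuous jj.symm.continuous hcanH γH hP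
      (Measure.map jj νH) rfl hjjp ρ hρ1 ψ (fun y => hψconj y _) (gφ φ) rfl
    -- (8) the scalar identity (★ PART 2 (a) + ★ B6)
    have hu : IsUnit ((finCharpolyTwo L v γH).eval (finGammaTwo L v γH)) := isUnit_eval_finCharpolyTwo_of_isLocalGRegular L v γH hreg
    have hg' : Matrix.reindex eI eI ((m false : GL {i : Fin (2 + 1) // decide (2 ≤ (i : ℕ)) = false} (w.1.adicCompletion L)) :
          Matrix {i : Fin (2 + 1) // decide (2 ≤ (i : ℕ)) = false} {i : Fin (2 + 1) // decide (2 ≤ (i : ℕ)) = false} (w.1.adicCompletion L)) =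
        (γH.1.val.val : Matrix (Fin 2) (Fin 2) (UnitaryGroup.LocalRing L v)).map (fun x => x w) := by
      rw [hg0, he₂]; rfl
    have ht' : ((m true : GL {j : Fin (2 + 1) // decide (2 ≤ (j : ℕ)) = true} (w.1.adicCompletion L)) :
          Matrix {j : Fin (2 + 1) // decide (2 ≤ (j : ℕ)) = true} {j : Fin (2 + 1) // decide (2 ≤ (j : ℕ)) = true} (w.1.adicCompletion L)) j₀ j₀ =
        finGammaTwo L v γH w := by
      rw [ht0, he₁]; rfl
    have hunit : (isUnit_det_fst_map_apply L v γH w).unit = Matrix.GeneralLinearGroup.det (leviProjection (w.1.adicCompletion L)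
        (fun i : Fin (2 + 1) => decide (2 ≤ (i : ℕ)))
        (⟨((leviEmbeddingP (w.1.adicCompletion L) (fun i : Fin (2 + 1) => decide (2 ≤ (i : ℕ))) m :
            ↥(standardParabolicGL (w.1.adicCompletion L) (fun i : Fin (2 + 1) => decide (2 ≤ (i : ℕ))))) : GL (Fin (2 + 1)) (w.1.adicCompletion L)),
          standardLeviGL_le (w.1.adicCompletion L) _ hpM⟩ :
          ↥(standardParabolicGL (w.1.adicCompletion L) (fun i : Fin (2 + 1) => decide (2 ≤ (i : ℕ))))) false) := by
      apply Units.ext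
      have hincl : (⟨((leviEmbeddingP (w.1.adicCompletion L) (fun i : Fin (2 + 1) => decide (2 ≤ (i : ℕ))) m :
            ↥(standardParabolicGL (w.1.adicCompletion L) (fun i : Fin (2 + 1) => decide (2 ≤ (i : ℕ))))) : GL (Fin (2 + 1)) (w.1.adicCompletion L)),
          standardLeviGL_le (w.1.adicCompletion L) _ hpM⟩ :
          ↥(standardParabolicGL (w.1.adicCompletion L) (fun i : Fin (2 + 1) => decide (2 ≤ (i : ℕ))))) =
          leviEmbeddingP (w.1.adicCompletion L) (fun i : Fin (2 + 1) => decide (2 ≤ (i : ℕ))) m := Subtype.ext rfl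
      rw [IsUnit.unit_spec, hincl, leviProjection_leviEmbeddingP_apply, Matrix.GeneralLinearGroup.val_det_apply, ← hg', Matrix.det_reindex_self]
    have hτ : finTau L v γH μ = (fun u : (w.1.adicCompletion L)ˣ => ((μ.localComponent w.1 u : ℂˣ) : ℂ))
        (Matrix.GeneralLinearGroup.det (leviProjection (w.1.adicCompletion L) (fun i : Fin (2 + 1) => decide (2 ≤ (i : ℕ)))
          (⟨((leviEmbeddingP (w.1.adicCompletion L) (fun i : Fin (2 + 1) => decide (2 ≤ (i : ℕ))) m :
              ↥(standardParabolicGL (w.1.adicCompletion L) (fun i : Fin (2 + 1) => decide (2 ≤ (i : ℕ))))) : GL (Fin (2 + 1)) (w.1.adicCompletion L)),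
            standardLeviGL_le (w.1.adicCompletion L) _ hpM⟩ :
            ↥(standardParabolicGL (w.1.adicCompletion L) (fun i : Fin (2 + 1) => decide (2 ≤ (i : ℕ))))) false)) := by
      rw [finTau_eq_localComponent_det_of_split L v γH w μ hw hdual hu, hunit]
    have hA2 := finExplicitDelta_mul_toReal_eq_of_split L v γH w H' m eI j₀ hj₀ hw μ h₀ hu hg' ht' hp1 C hτ
    rw [norm_eq_coe_normAbs_adicCompletion] at hA2
    -- (9) glue (★ PART 1 (G1))
    rw [finExplicitCollection_Δ]
    exact classOrbital_pair_identity_of_sides hL hR hA2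

end PartTwoB

end Literature.NumberTheory.Rogawski1990

end
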